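import Summits.QuantumFields.YangMills.Theses.DirichletWindow
import Literature.MathematicalPhysics.QuantumLattice.LatticeGaugeDLRGibbsProofs
import Literature.MathematicalPhysics.QuantumLattice.ContinuumLimitLGT

/-!
# Birth skeleton (BC3) — crux `DirichletWindow.BackgroundBudget` (item stmt-QuantumFields-12315)

Route `route-QuantumFields-DirichletWindow`, sub-problem `YangMills`, crux (rank 2)
`Summit.QuantumFields.YangMills.Theses.DirichletWindow.BackgroundBudget` — the EQUIPARTITION BUDGET:
for compact simple `G` and faithful `r`, IF `f_r(β) + (3D/2) log β` converges THEN for every window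
exponent `θ ∈ (0, 1/16]` and `δ > 0`, eventually in `β`, EVERY torus-limit state
`μ ∈ infiniteVolumeLimitPoints r.ρ β` satisfies, with `Λ` = the edges based in `{-L..L}⁴`,
`L = ⌈β^θ⌉`, `good` = {every plaquette touching `Λ` has `N - Re tr r(U_p) ≤ β^(-15/16)`},
`ν_η = γ_Λ(· | η)` conditioned on `good` and `D_y(η) = ν_η(N - Re tr U_y) - ν_1(N - Re tr U_y)`
(conditional EXCESS ACTION of the (0,1)-plaquette at `y` against flat Dirichlet data):
(c) `μ{ω : γ_Λ(good | ω) < 1/2} ≤ δ/β²`, and for axial `y = n e₀`, `n ≤ L/2`: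
(a) `D_y ∈ L¹(μ)`, `|E_μ D_y| ≤ δ/β`; (b) `E_μ D_y² ≤ δ/β²`.

Registrar `planner-skel-stmt-QuantumFields-12315-0` (skeleton-register one-shot, 2026-08-17; re-audit
bin REPAIRABLE). `Cruxes/BackgroundBudget/` had NO workfile at registration (no `Disproof.lean`, no
Ideas, no Lines): nothing to honour under "Disproof used".

## The cut — the route header's own TWO-LAYER PLAN for this node, one stub per proof technique

* `stub_largeFieldRarity` — **(c′) LARGE-FIELD RARITY in the window, for every torus-limit state**:
  `∀ θ ∈ (0,1/16], ∀ δ > 0, ∃ β₁, ∀ β ≥ β₁, ∀ μ ∈ infiniteVolumeLimitPoints r.ρ β, μ(goodᶜ) ≤ δ/β²`.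
  STRONGER than clause (c) and exactly the export the glue crux `WindowReduction` (stmt-12317) was
  found to need (refuter objection `Objection_BackgroundBudget_c.md`, retriage SIGNATURE REMARK
  2026-08-15: "(c) exports only the Markov shadow of μ(goodᶜ) ≤ δ/β²"); it does NOT use the
  free-energy hypothesis.  Technique: chessboard estimate from reflection positivity with the
  elementary partition-function lower bound (restrict Haar to a `β^{-1/2}`-ball), plaquette rarity of
  the shape `μ_T(N - Re tr U_p > τ) ≤ β^{C dim G} e^{-c βτ}` uniformly in the (even) torus `T`,
  `τ = β^{-15/16}`, union over the `≍ β^{4θ} ≤ β^{1/4}` plaquettes touching `Λ`, passage to limit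
  states (FrohlichIsraelLiebSimon1978 §4 chessboard estimates, SeilerLNP1982 Ch. 2–3, BorgsSeiler1983).
  Why it might fail: chessboard bounds are in print (RP in tree:
  `wilsonExpectation_siteReflectionPositive`, EVEN side) for EVEN tori; `infiniteVolumeLimitPoints`
  admits every subsequence of sides `L_k + 1`, odd ones included
  (`wilsonExpectation_oddReflectionPositive` gives RP for odd `L ≥ 3`, not yet a chessboard estimate).
  Size: L.
* `stub_equipartitionMean` — **(a) EQUIPARTITION MEAN BUDGET** (clause (a) verbatim, conditional on
  the sharp free energy): `D_y` is `μ`-integrable and `|E_μ D_y| ≤ δ/β` for `n ≤ L/2`.  Technique: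
  DLR identity `E_μ[ν_η(s_y)] = E_μ[s_y] + O(μ-bad)`, translation invariance, Griffiths' lemma /
  subgradient squeeze on the convex torus free energies (`β E_μ[N - Re tr U_p] → D/4` in EVERY limit
  state from `f_r(β) + (3D/2) log β → K`), and the flat-box centre mean `β ν_1(s_y) → D/4`
  (one-scale Gaussian computation with Dirichlet propagator, boundary effect `O(L^{-2}) = O(β^{-2θ})`).
  Why it might fail: the flat-box mean needs the small-field Laplace expansion of the CONDITIONED
  kernel `ν_1` to relative `o(1)` uniformly in `n ≤ L/2` (anharmonic remainder `L⁶β^{-13/32}`, fine for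
  `θ ≤ 1/16` only with the crude one-scale bounds actually closing).  Size: L.
* `stub_secondMomentBudget` — **(b) SECOND-MOMENT BUDGET** (clause (b) verbatim): `E_μ D_y² ≤ δ/β²`.
  Technique: chessboard exponential-moment (large-deviation) bound for the block-averaged action with
  the SHARP free energy, `P_μ(ℓ⁴-block excess ≥ δ₁/β per plaquette) ≤ exp(-ℓ⁴(2δ₁²/D - o(1)))`, plus
  "large `D_y` forces a `ν_η`-typical block excess" (interior regularity of the constrained
  small-field minimiser, conditional concentration).  Why it might fail: THE thin point of the route —
  an intermittent state with coherent curvature `~(log β/β)^{1/2}` at probability `~1/log β` passes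
  (a) yet breaks (b); odd tori as in (c′).  Size: XL (hardest stub).

`BackgroundBudget_of` is a REAL proof (no `sorry`): thresholds `β₁ := max` of the three; clauses
(a), (b) are read off the stubs; clause (c) is DERIVED from (c′) at `δ/2` by the DLR equations for
torus-limit states (tree `mem_ymGibbsMeasures_of_mem_infiniteVolumeLimitPoints_holds`:
`∫ γ_Λ(goodᶜ | ω) dμ(ω) = μ(goodᶜ)`), the kernels being probability measures
(`isProbabilityMeasure_ymSpecification`: `γ(good|ω) < 1/2 ⇒ γ(goodᶜ|ω) ≥ 1/2`), measurability of
`ω ↦ γ_Λ(goodᶜ | ω)` (`measurable_ymSpecification_apply`) and Markov's inequality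
(`mul_meas_ge_le_lintegral`): `μ{γ(good|·) < 1/2} ≤ 2 μ(goodᶜ) ≤ 2·(δ/2)/β²`; the Hausdorff /
second-countable structure of `G` comes from the faithful representation `r` (closed embedding into
matrices), measurability of `good` from `measurable_plaquetteObs` (finite intersection of sublevel sets).

Layout (D-0027 §3.3 shape, as `CardyFormulaZ2/Cruxes/IsingJetsConformal/Lines/birth.lean`): § Stubs as
named `Prop`s (`Stubs.stub_*`, the hypotheses of `BackgroundBudget_of` BY NAME — the `@[stub]` tag is
gate-reserved, admissibility is by the short name) · § registered stubs (`stub_*`, verbatim restatements,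
the ONLY `sorry`s of the file) · § DLR–Markov lemma · § `BackgroundBudget_of` · closing `example`
(`BackgroundBudget_of stub₁ stub₂ stub₃ : BackgroundBudget`, the two spellings agree definitionally).
BC3 probes (registrar folder `bc/probe_*.lean`): `stub → BackgroundBudget` and `stub → YangMills` by
`first | exact? | simpa | aesop` FAIL for all three stubs (see `Lines/birth.md`).
-/

noncomputable section

namespace Summit.QuantumFields.YangMills.Cruxes.BackgroundBudget.Birth

open MeasureTheory Filter Topology
open Literature.MathematicalPhysics.QuantumLattice
open Summit.QuantumFields.YangMills.Theses.DirichletWindow (BackgroundBudget)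

/-! ### § 1. The three stub statements as named `Prop`s (hypotheses of `BackgroundBudget_of` BY NAME) -/

namespace Stubs

/-- Stub `Prop` (c′) — large-field rarity in the Dirichlet window for every torus-limit state
(registered stub: the theorem `stub_largeFieldRarity` below). -/
def stub_largeFieldRarity : Prop :=
  ∀ (G : Type) [Group G] [TopologicalSpace G] [IsTopologicalGroup G] [CompactSpace G] [MeasurableSpace G] [BorelSpace G], Literature.MathematicalPhysics.QuantumFieldTheory.IsCompactSimpleLieGroup G → ∀ r : Literature.MathematicalPhysics.QuantumFieldTheory.LatticeRep G, ∀ θ : ℝ, 0 < θ → θ ≤ 1 / 16 → ∀ δ : ℝ, 0 < δ → ∃ β₁ : ℝ, ∀ β : ℝ, β₁ ≤ β → ∀ μ ∈ Literature.MathematicalPhysics.QuantumLattice.infiniteVolumeLimitPoints (d := 4) r.ρ β, let Λ : Finset (Literature.MathematicalPhysics.QuantumLattice.ZdEdge 4) := Literature.Probability.LatticeModels.box 4 ⌈β ^ θ⌉₊ ×ˢ (Finset.univ : Finset (Fin 4)); let good : Set (Literature.MathematicalPhysics.QuantumLattice.LGConfig 4 G) := {U | ∀ p ∈ Literature.MathematicalPhysics.QuantumLattice.plaquettesTouching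 Λ, (r.N : ℝ) - Literature.MathematicalPhysics.QuantumLattice.plaquetteObs r.ρ p.1 p.2.1.1 p.2.1.2 U ≤ β ^ (-(15 : ℝ) / 16)}; μ goodᶜ ≤ ENNReal.ofReal (δ / β ^ 2)

/-- Stub `Prop` (a) — equipartition mean budget (registered stub: `stub_equipartitionMean`). -/
def stub_equipartitionMean : Prop :=
  ∀ (G : Type) [Group G] [TopologicalSpace G] [IsTopologicalGroup G] [CompactSpace G] [MeasurableSpace G] [BorelSpace G], Literature.MathematicalPhysics.QuantumFieldTheory.IsCompactSimpleLieGroup G → ∀ r : Literature.MathematicalPhysics.QuantumFieldTheory.LatticeRep G, (∃ K : ℝ, Filter.Tendsto (fun β : ℝ => Literature.MathematicalPhysics.QuantumLattice.freeEnergyDensity 4 r.ρ β + (3 * (Module.finrank ℝ ↥(Submodule.span ℝ {X : Matrix (Fin r.N) (Fin r.N) ℂ | ∀ t : ℝ, NormedSpace.exp ((t : ℂ) • X) ∈ Set.range r.ρ}) : ℝ) / 2) * Real.log β) Filter.atTop (nhds K)) → ∀ θ : ℝ, 0 < θ → θ ≤ 1 / 16 → ∀ δ : ℝ, 0 < δ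 → ∃ β₁ : ℝ, ∀ β : ℝ, β₁ ≤ β → ∀ μ ∈ Literature.MathematicalPhysics.QuantumLattice.infiniteVolumeLimitPoints (d := 4) r.ρ β, let Λ : Finset (Literature.MathematicalPhysics.QuantumLattice.ZdEdge 4) := Literature.Probability.LatticeModels.box 4 ⌈β ^ θ⌉₊ ×ˢ (Finset.univ : Finset (Fin 4)); let good : Set (Literature.MathematicalPhysics.QuantumLattice.LGConfig 4 G) := {U | ∀ p ∈ Literature.MathematicalPhysics.QuantumLattice.plaquettesTouching Λ, (r.N : ℝ) - Literature.MathematicalPhysics.QuantumLattice.plaquetteObs r.ρ p.1 p.2.1.1 p.2.1.2 U ≤ β ^ (-(15 : ℝ) / 16)}; let ν : Literature.MathematicalPhysics.QuantumLattice.LGConfig 4 G → MeasureTheory.Measure (Literature.MathematicalPhysics.QuantumLattice.LGConfig 4 G) := fun η => ProbabilityTheory.cond (Literature.MathematicalPhysics.QuantumLattice.ymSpecification r.ρ β Λ η) good; let D : Literature.Probability.LatticeModels.Site 4 → Literature.MathematicalPhysics.QuantumLattice.LGConfig 4 G → ℝ := fun y η => (∫ U, ((r.N : ℝ) - Literature.MathematicalPhysics.QuantumLattice.plaquetteObs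 r.ρ y 0 1 U) ∂(ν η)) - ∫ U, ((r.N : ℝ) - Literature.MathematicalPhysics.QuantumLattice.plaquetteObs r.ρ y 0 1 U) ∂(ν 1); ∀ n : ℕ, (n : ℝ) ≤ ⌈β ^ θ⌉₊ / 2 → MeasureTheory.Integrable (D ((n : ℤ) • Pi.single (0 : Fin 4) (1 : ℤ))) μ ∧ |∫ ω, D ((n : ℤ) • Pi.single (0 : Fin 4) (1 : ℤ)) ω ∂μ| ≤ δ / β

/-- Stub `Prop` (b) — second-moment budget (registered stub: `stub_secondMomentBudget`). -/
def stub_secondMomentBudget : Prop :=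
  ∀ (G : Type) [Group G] [TopologicalSpace G] [IsTopologicalGroup G] [CompactSpace G] [MeasurableSpace G] [BorelSpace G], Literature.MathematicalPhysics.QuantumFieldTheory.IsCompactSimpleLieGroup G → ∀ r : Literature.MathematicalPhysics.QuantumFieldTheory.LatticeRep G, (∃ K : ℝ, Filter.Tendsto (fun β : ℝ => Literature.MathematicalPhysics.QuantumLattice.freeEnergyDensity 4 r.ρ β + (3 * (Module.finrank ℝ ↥(Submodule.span ℝ {X : Matrix (Fin r.N) (Fin r.N) ℂ | ∀ t : ℝ, NormedSpace.exp ((t : ℂ) • X) ∈ Set.range r.ρ}) : ℝ) / 2) * Real.log β) Filter.atTop (nhds K)) → ∀ θ : ℝ, 0 < θ → θ ≤ 1 / 16 → ∀ δ : ℝ, 0 < δ → ∃ β₁ : ℝ, ∀ β : ℝ, β₁ ≤ β → ∀ μ ∈ Literature.MathematicalPhysics.QuantumLattice.infiniteVolumeLimitPoints (d := 4) r.ρ β, let Λ : Finset (Literature.MathematicalPhysics.QuantumLattice.ZdEdge 4) := Literature.Probability.LatticeModels.box 4 ⌈β ^ θ⌉₊ ×ˢ (Finset.univ : Finset (Fin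 4)); let good : Set (Literature.MathematicalPhysics.QuantumLattice.LGConfig 4 G) := {U | ∀ p ∈ Literature.MathematicalPhysics.QuantumLattice.plaquettesTouching Λ, (r.N : ℝ) - Literature.MathematicalPhysics.QuantumLattice.plaquetteObs r.ρ p.1 p.2.1.1 p.2.1.2 U ≤ β ^ (-(15 : ℝ) / 16)}; let ν : Literature.MathematicalPhysics.QuantumLattice.LGConfig 4 G → MeasureTheory.Measure (Literature.MathematicalPhysics.QuantumLattice.LGConfig 4 G) := fun η => ProbabilityTheory.cond (Literature.MathematicalPhysics.QuantumLattice.ymSpecification r.ρ β Λ η) good; let D : Literature.Probability.LatticeModels.Site 4 → Literature.MathematicalPhysics.QuantumLattice.LGConfig 4 G → ℝ := fun y η => (∫ U, ((r.N : ℝ) - Literature.MathematicalPhysics.QuantumLattice.plaquetteObs r.ρ y 0 1 U) ∂(ν η)) - ∫ U, ((r.N : ℝ) - Literature.MathematicalPhysics.QuantumLattice.plaquetteObs r.ρ y 0 1 U) ∂(ν 1); ∀ n : ℕ, (n : ℝ) ≤ ⌈β ^ θ⌉₊ / 2 → ∫⁻ ω, ENNReal.ofReal (D ((n : ℤ) •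 Pi.single (0 : Fin 4) (1 : ℤ)) ω ^ 2) ∂μ ≤ ENNReal.ofReal (δ / β ^ 2)

end Stubs

/-! ### § 2. The registered stubs — the ONLY `sorry`s of this file (verbatim restatements of § 1) -/

/-- **Stub (c′) `stub_largeFieldRarity` — large-field rarity in the window, every torus-limit state.**
For compact simple `G`, faithful `r`, `θ ∈ (0, 1/16]`, `δ > 0`: eventually in `β`, every
`μ ∈ infiniteVolumeLimitPoints r.ρ β` gives the BAD event (some plaquette touching the box of edges
based in `{-⌈β^θ⌉..⌈β^θ⌉}⁴` has `N - Re tr r(U_p) > β^(-15/16)`) probability `≤ δ/β²`.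
Chessboard / RP plaquette rarity `≤ β^C e^{-cβ^{1/16}}` summed over `≍ β^{4θ}` plaquettes; odd tori owed. -/
theorem stub_largeFieldRarity :
    (∀ (G : Type) [Group G] [TopologicalSpace G] [IsTopologicalGroup G] [CompactSpace G] [MeasurableSpace G] [BorelSpace G], Literature.MathematicalPhysics.QuantumFieldTheory.IsCompactSimpleLieGroup G → ∀ r : Literature.MathematicalPhysics.QuantumFieldTheory.LatticeRep G, ∀ θ : ℝ, 0 < θ → θ ≤ 1 / 16 → ∀ δ : ℝ, 0 < δ → ∃ β₁ : ℝ, ∀ β : ℝ, β₁ ≤ β → ∀ μ ∈ Literature.MathematicalPhysics.QuantumLattice.infiniteVolumeLimitPoints (d := 4) r.ρ β, let Λ : Finset (Literature.MathematicalPhysics.QuantumLattice.ZdEdge 4) := Literature.Probability.LatticeModels.box 4 ⌈β ^ θ⌉₊ ×ˢ (Finset.univ : Finset (Fin 4)); let good : Set (Literature.MathematicalPhysics.QuantumLattice.LGConfig 4 G) := {U | ∀ p ∈ Literature.MathematicalPhysics.QuantumLattice.plaquettesTouching Λ, (r.N : ℝ) - Literature.MathematicalPhysics.QuantumLattice.plaquetteObs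 r.ρ p.1 p.2.1.1 p.2.1.2 U ≤ β ^ (-(15 : ℝ) / 16)}; μ goodᶜ ≤ ENNReal.ofReal (δ / β ^ 2)) := by
  sorry

/-- **Stub (a) `stub_equipartitionMean` — equipartition mean budget** (clause (a) of the crux,
conditional on the sharp free energy `f_r(β) + (3D/2) log β → K`): for `n ≤ ⌈β^θ⌉/2` the conditional
excess action `D_{n e₀}` is `μ`-integrable and `|E_μ D_{n e₀}| ≤ δ/β`, for every torus-limit state. -/
theorem stub_equipartitionMean :
    (∀ (G : Type) [Group G] [TopologicalSpace G] [IsTopologicalGroup G] [CompactSpace G] [MeasurableSpace G] [BorelSpace G], Literature.MathematicalPhysics.QuantumFieldTheory.IsCompactSimpleLieGroup G → ∀ r : Literature.MathematicalPhysics.QuantumFieldTheory.LatticeRep G, (∃ K : ℝ, Filter.Tendsto (fun β : ℝ => Literature.MathematicalPhysics.QuantumLattice.freeEnergyDensity 4 r.ρ β + (3 * (Module.finrank ℝ ↥(Submodule.span ℝ {X : Matrix (Fin r.N) (Fin r.N) ℂ | ∀ t : ℝ, NormedSpace.exp ((t : ℂ) • X) ∈ Set.range r.ρ}) : ℝ)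 / 2) * Real.log β) Filter.atTop (nhds K)) → ∀ θ : ℝ, 0 < θ → θ ≤ 1 / 16 → ∀ δ : ℝ, 0 < δ → ∃ β₁ : ℝ, ∀ β : ℝ, β₁ ≤ β → ∀ μ ∈ Literature.MathematicalPhysics.QuantumLattice.infiniteVolumeLimitPoints (d := 4) r.ρ β, let Λ : Finset (Literature.MathematicalPhysics.QuantumLattice.ZdEdge 4) := Literature.Probability.LatticeModels.box 4 ⌈β ^ θ⌉₊ ×ˢ (Finset.univ : Finset (Fin 4)); let good : Set (Literature.MathematicalPhysics.QuantumLattice.LGConfig 4 G) := {U | ∀ p ∈ Literature.MathematicalPhysics.QuantumLattice.plaquettesTouching Λ, (r.N : ℝ) - Literature.MathematicalPhysics.QuantumLattice.plaquetteObs r.ρ p.1 p.2.1.1 p.2.1.2 U ≤ β ^ (-(15 : ℝ) / 16)}; let ν : Literature.MathematicalPhysics.QuantumLattice.LGConfig 4 G → MeasureTheory.Measure (Literature.MathematicalPhysics.QuantumLattice.LGConfig 4 G) := fun η => ProbabilityTheory.cond (Literature.MathematicalPhysics.QuantumLattice.ymSpecification r.ρ β Λ η) good; let D : Literature.Probability.LatticeModels.Site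 4 → Literature.MathematicalPhysics.QuantumLattice.LGConfig 4 G → ℝ := fun y η => (∫ U, ((r.N : ℝ) - Literature.MathematicalPhysics.QuantumLattice.plaquetteObs r.ρ y 0 1 U) ∂(ν η)) - ∫ U, ((r.N : ℝ) - Literature.MathematicalPhysics.QuantumLattice.plaquetteObs r.ρ y 0 1 U) ∂(ν 1); ∀ n : ℕ, (n : ℝ) ≤ ⌈β ^ θ⌉₊ / 2 → MeasureTheory.Integrable (D ((n : ℤ) • Pi.single (0 : Fin 4) (1 : ℤ))) μ ∧ |∫ ω, D ((n : ℤ) • Pi.single (0 : Fin 4) (1 : ℤ)) ω ∂μ| ≤ δ / β) := by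
  sorry

/-- **Stub (b) `stub_secondMomentBudget` — second-moment budget** (clause (b) of the crux, conditional on
the sharp free energy): for `n ≤ ⌈β^θ⌉/2`, `E_μ D_{n e₀}² ≤ δ/β²` (as a lower Lebesgue integral), for
every torus-limit state — the chessboard large-deviation bound with the SHARP free energy plus interior
regularity of the constrained small-field minimiser; the thin point of the route. -/
theorem stub_secondMomentBudget :
    (∀ (G : Type) [Group G] [TopologicalSpace G] [IsTopologicalGroup G] [CompactSpace G] [MeasurableSpace G] [BorelSpace G], Literature.MathematicalPhysics.QuantumFieldTheory.IsCompactSimpleLieGroup G → ∀ r : Literature.MathematicalPhysics.QuantumFieldTheory.LatticeRep G, (∃ K : ℝ, Filter.Tendsto (fun β : ℝ => Literature.MathematicalPhysics.QuantumLattice.freeEnergyDensity 4 r.ρ β + (3 * (Module.finrank ℝ ↥(Submodule.span ℝ {X : Matrix (Fin r.N) (Fin r.N) ℂ | ∀ t : ℝ, NormedSpace.exp ((t : ℂ) • X) ∈ Set.range r.ρ}) : ℝ) / 2) * Real.log β) Filter.atTop (nhds K)) → ∀ θ : ℝ, 0 < θ → θ ≤ 1 / 16 → ∀ δ : ℝ,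 0 < δ → ∃ β₁ : ℝ, ∀ β : ℝ, β₁ ≤ β → ∀ μ ∈ Literature.MathematicalPhysics.QuantumLattice.infiniteVolumeLimitPoints (d := 4) r.ρ β, let Λ : Finset (Literature.MathematicalPhysics.QuantumLattice.ZdEdge 4) := Literature.Probability.LatticeModels.box 4 ⌈β ^ θ⌉₊ ×ˢ (Finset.univ : Finset (Fin 4)); let good : Set (Literature.MathematicalPhysics.QuantumLattice.LGConfig 4 G) := {U | ∀ p ∈ Literature.MathematicalPhysics.QuantumLattice.plaquettesTouching Λ, (r.N : ℝ) - Literature.MathematicalPhysics.QuantumLattice.plaquetteObs r.ρ p.1 p.2.1.1 p.2.1.2 U ≤ β ^ (-(15 : ℝ) / 16)}; let ν : Literature.MathematicalPhysics.QuantumLattice.LGConfig 4 G → MeasureTheory.Measure (Literature.MathematicalPhysics.QuantumLattice.LGConfig 4 G) := fun η => ProbabilityTheory.cond (Literature.MathematicalPhysics.QuantumLattice.ymSpecification r.ρ β Λ η) good; let D : Literature.Probability.LatticeModels.Site 4 → Literature.MathematicalPhysics.QuantumLattice.LGConfig 4 G → ℝ := fun y η => (∫ U, ((r.N : ℝ)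 - Literature.MathematicalPhysics.QuantumLattice.plaquetteObs r.ρ y 0 1 U) ∂(ν η)) - ∫ U, ((r.N : ℝ) - Literature.MathematicalPhysics.QuantumLattice.plaquetteObs r.ρ y 0 1 U) ∂(ν 1); ∀ n : ℕ, (n : ℝ) ≤ ⌈β ^ θ⌉₊ / 2 → ∫⁻ ω, ENNReal.ofReal (D ((n : ℤ) • Pi.single (0 : Fin 4) (1 : ℤ)) ω ^ 2) ∂μ ≤ ENNReal.ofReal (δ / β ^ 2)) := by
  sorry

/-! ### § 3. The DLR–Markov lemma (sorry-free): `μ{γ_Λ(A|·) < 1/2} ≤ 2 μ(Aᶜ)` for DLR states -/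

/-- For a DLR state `μ` of the Wilson specification at `β` and a measurable event `A`: the set of
exterior data whose kernel gives `A` probability `< 1/2` has `μ`-measure at most `2 μ(Aᶜ)`
(DLR equation `∫ γ_Λ(Aᶜ|ω) dμ = μ(Aᶜ)`, `γ_Λ(·|ω)` a probability measure, Markov). -/
theorem measure_kernel_lt_half_le {G : Type} [Group G] [TopologicalSpace G] [IsTopologicalGroup G]
    [CompactSpace G] [MeasurableSpace G] [BorelSpace G] [SecondCountableTopology G] {N : ℕ}
    (ρ : G →* Matrix (Fin N) (Fin N) ℂ) (hρ : Continuous ρ) (β : ℝ)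
    {μ : Measure (LGConfig 4 G)} (hμ : μ ∈ ymGibbsMeasures (d := 4) ρ β)
    (Λ : Finset (ZdEdge 4)) {A : Set (LGConfig 4 G)} (hA : MeasurableSet A) :
    μ {ω | ymSpecification ρ β Λ ω A < 2⁻¹} ≤ 2 * μ Aᶜ := by
  have hDLR : ∫⁻ η, ymSpecification ρ β Λ η Aᶜ ∂μ = μ Aᶜ := hμ.2 Λ Aᶜ hA.compl
  have hsub : {ω | ymSpecification ρ β Λ ω A < 2⁻¹} ⊆
      {ω | (2⁻¹ : ENNReal) ≤ ymSpecification ρ β Λ ω Aᶜ} := by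
    intro ω hω
    haveI := isProbabilityMeasure_ymSpecification ρ hρ β Λ ω
    rw [Set.mem_setOf_eq] at hω ⊢
    rw [prob_compl_eq_one_sub hA]
    calc (2⁻¹ : ENNReal) = 1 - 2⁻¹ := ENNReal.one_sub_inv_two.symm
      _ ≤ 1 - ymSpecification ρ β Λ ω A := tsub_le_tsub_left hω.le 1
  have hmeas : Measurable fun η => ymSpecification ρ β Λ η Aᶜ :=
    measurable_ymSpecification_apply ρ hρ β Λ hA.compl
  calc μ {ω | ymSpecification ρ β Λ ω A < 2⁻¹}
      ≤ μ {ω | (2⁻¹ : ENNReal) ≤ ymSpecification ρ β Λ ω Aᶜ} := measure_mono hsub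
    _ = 2 * (2⁻¹ * μ {ω | (2⁻¹ : ENNReal) ≤ ymSpecification ρ β Λ ω Aᶜ}) := by
        rw [← mul_assoc, ENNReal.mul_inv_cancel (by norm_num) (by norm_num), one_mul]
    _ ≤ 2 * ∫⁻ η, ymSpecification ρ β Λ η Aᶜ ∂μ :=
        mul_le_mul_right (mul_meas_ge_le_lintegral hmeas 2⁻¹) 2
    _ = 2 * μ Aᶜ := by rw [hDLR]

/-! ### § 4. The composition — hypotheses = the three stub `Prop`s BY NAME, conclusion = the crux BY NAME -/

/-- **`BackgroundBudget_of`**: `Stubs.stub_largeFieldRarity → Stubs.stub_equipartitionMean →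
Stubs.stub_secondMomentBudget → DirichletWindow.BackgroundBudget` (REAL proof).  Thresholds: the max of
the three.  Clauses (a), (b): the stubs at `(θ, δ)`.  Clause (c): rarity (c′) at `δ/2`, then DLR + Markov
(`measure_kernel_lt_half_le`): `μ{γ_Λ(good|·) < 1/2} ≤ 2 μ(goodᶜ) ≤ 2 · (δ/2)/β² = δ/β²`; `G` is
Hausdorff and second countable through the faithful `r`, `good` is measurable as a finite intersection
of sublevel sets of continuous plaquette observables, and `μ` is a DLR state by
`mem_ymGibbsMeasures_of_mem_infiniteVolumeLimitPoints_holds`. -/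
theorem BackgroundBudget_of (hc : Stubs.stub_largeFieldRarity) (ha : Stubs.stub_equipartitionMean)
    (hb : Stubs.stub_secondMomentBudget) : BackgroundBudget := by
  unfold Stubs.stub_largeFieldRarity at hc
  unfold Stubs.stub_equipartitionMean at ha
  unfold Stubs.stub_secondMomentBudget at hb
  intro G _ _ _ _ _ _ hG r hfe θ hθ hθ' δ hδ
  obtain ⟨β₁, h₁⟩ := hc G hG r θ hθ hθ' (δ / 2) (half_pos hδ)
  obtain ⟨β₂, h₂⟩ := ha G hG r hfe θ hθ hθ' δ hδ
  obtain ⟨β₃, h₃⟩ := hb G hG r hfe θ hθ hθ' δ hδ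
  refine ⟨max β₁ (max β₂ β₃), fun β hβ μ hμ => ?_⟩
  have hβ₁ : β₁ ≤ β := (le_max_left _ _).trans hβ
  have hβ₂ : β₂ ≤ β := ((le_max_left _ _).trans (le_max_right _ _)).trans hβ
  have hβ₃ : β₃ ≤ β := ((le_max_right _ _).trans (le_max_right _ _)).trans hβ
  intro Λ good ν D
  have k₁ : μ goodᶜ ≤ ENNReal.ofReal (δ / 2 / β ^ 2) := h₁ β hβ₁ μ hμ
  have k₂ := h₂ β hβ₂ μ hμ
  have k₃ := h₃ β hβ₃ μ hμ
  refine ⟨?_, fun n hn => ⟨(k₂ n hn).1, (k₂ n hn).2, k₃ n hn⟩⟩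
  -- clause (c) from (c′): DLR + Markov
  haveI : SecondCountableTopology G :=
    (r.continuous.isClosedEmbedding r.injective).isEmbedding.secondCountableTopology
  haveI : T2Space G := (r.continuous.isClosedEmbedding r.injective).isEmbedding.t2Space
  have hGibbs : μ ∈ ymGibbsMeasures (d := 4) r.ρ β :=
    mem_ymGibbsMeasures_of_mem_infiniteVolumeLimitPoints_holds r.ρ r.continuous hμ
  have hgood : MeasurableSet good := by
    have hrepr : good = ⋂ p ∈ plaquettesTouching Λ, {U : LGConfig 4 G |
        (r.N : ℝ) - plaquetteObs r.ρ p.1 p.2.1.1 p.2.1.2 U ≤ β ^ (-(15 : ℝ) / 16)} := by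
      ext U
      simp only [good, Set.mem_setOf_eq, Set.mem_iInter]
    rw [hrepr]
    exact (plaquettesTouching Λ).measurableSet_biInter fun p _ =>
      measurableSet_le (measurable_const.sub (measurable_plaquetteObs r.ρ r.continuous _ _ _))
        measurable_const
  have hkey := measure_kernel_lt_half_le r.ρ r.continuous β hGibbs Λ hgood
  have hx : 0 ≤ δ / 2 / β ^ 2 := by positivity
  calc μ {ω | ymSpecification r.ρ β Λ ω good < 2⁻¹}
      ≤ 2 * μ goodᶜ := hkey
    _ ≤ 2 * ENNReal.ofReal (δ / 2 / β ^ 2) := mul_le_mul_right k₁ 2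
    _ = ENNReal.ofReal (δ / β ^ 2) := by
        rw [two_mul, ← ENNReal.ofReal_add hx hx]
        congr 1
        ring

/-- Signature match (kernel-checked): the registered stubs instantiate the hypotheses of
`BackgroundBudget_of`, i.e. the crux modulo exactly the three declared stubs. -/
example : BackgroundBudget :=
  BackgroundBudget_of stub_largeFieldRarity stub_equipartitionMean stub_secondMomentBudget

end Summit.QuantumFields.YangMills.Cruxes.BackgroundBudget.Birth

end
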